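import Summits.FinalStateConjecture.FinalStateConjecture.Theorems.ClusterCompletenessAdiabaticMultiKerrILEDRedShiftLocalWeighted

/-!
# Route ClusterCompleteness — crux `AdiabaticMultiKerrILED`, line `Sketch`: local red-shift
# estimate, part 3/3 (the stub `stub_redShiftLocal`: the limit `ε → 0`)

Helper file for the crux `stmt-FinalStateConjecture-14310`
(`Summit.FinalStateConjecture.FinalStateConjecture.Theses.ClusterCompleteness.AdiabaticMultiKerrILED`),
closing the stub `stub_redShiftLocal` of line `Sketch`: the red-shift estimate between admissible
graph leaves `Literature.Geometry.Lorentzian.Kerr.redShift_estimate` (Dafermos–Rodnianski–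
Shlapentokh-Rothman arXiv:1402.7034, Prop. 4.5.2 / first display of §13.2; Dafermos–Rodnianski
arXiv:0811.0354, §3.3.3, Thm. 7.1) with the Kerr wave equation assumed only at exterior points of
the collar `{r ≤ r₊ + η}` in the future of the initial leaf `{x⁰ ≥ F(x⃗)}`. Proof: the Literature
proof verbatim — the equation is transferred pointwise to the surgered background
(`KerrSchild.waveOperator_congr_of_eventuallyEq`,
`Kerr.surgeryBackground_inverseMetric_eventuallyEq`) and fed to the local weighted estimate
`redShift_weighted_estimate_local` (part 2/3) at receding parameter `ε = 1/(n+1)`; the exhaustion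
`n → ∞` is `redShift_lintegral_exhaustion` (part 1/3).
-/

noncomputable section

-- the doubled `FinalStateConjecture.FinalStateConjecture` path component trips dupNamespace
set_option linter.dupNamespace false

open Set Filter Metric MeasureTheory
open scoped Topology ENNReal
open Literature.Geometry.Lorentzian Literature.Geometry.Lorentzian.Kerr

namespace Summit.FinalStateConjecture.FinalStateConjecture.Cruxes.AdiabaticMultiKerrILED.Sketch

/-- **The red-shift estimate between admissible graph leaves, local hypotheses**
(Dafermos–Rodnianski–Shlapentokh-Rothman arXiv:1402.7034, Prop. 4.5.2 with the zeroth order terms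
removed, first display (boundedEnergyHorizon) of §13.2; Dafermos–Rodnianski arXiv:0811.0354, §3.3.3
and Thm. 7.1): `Kerr.redShift_estimate` with the Kerr wave equation assumed only at exterior points
`x` with `r(x) ≤ r₊ + η` and `F(x⃗) ≤ x⁰`. For subextremal `(M, a)` there is `η₀ > 0` such that for
every
`0 < η ≤ η₀` there is `C > 0` with, for every `C²` height `F` of slope `‖dF‖ ≤ 1 − c` (`0 < c ≤ 1`),
every `Φ` of class `C²` on `{r > r₊}` solving the equation where stated, and every `s ≥ 0`,
`∫_{Σ̃_s ∩ {r₊ < r ≤ r₊ + η/2}} e[Φ] + ∫_0^s ∫_{Σ̃_u ∩ {r₊ < r ≤ r₊ + η/2}} e[Φ]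
  ≤ (C/c) (∫_{Σ̃_0 ∩ {r₊ < r ≤ r₊ + η}} e[Φ] + ∫_0^s ∫_{Σ̃_u ∩ {r₊ + η/2 ≤ r ≤ r₊ + η}} e[Φ])`
in `[0, ∞]` (`Σ̃_u = {(u + F(y), y)}`, `e[Φ] = ∑_μ (∂_μΦ)²`). Proof:
`redShift_weighted_estimate_local` at `ε = 1/(n+1)` written with Lebesgue integrals, and
`redShift_lintegral_exhaustion`.
[cite: DafermosRodnianskiShlapentokhrothman2014, Prop. 4.5.2 and §13.2] -/
theorem stub_redShiftLocal :
    ∀ (M a : ℝ), Kerr.IsSubextremal M a →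
    ∃ η₀ : ℝ, 0 < η₀ ∧ ∀ η : ℝ, 0 < η → η ≤ η₀ → ∃ C : ℝ, 0 < C ∧
      ∀ (F : E3 → ℝ) (c : ℝ), ContDiff ℝ 2 F → 0 < c → c ≤ 1 →
      (∀ y, ‖fderiv ℝ F y‖ ≤ 1 - c) →
      ∀ Φ : E4 → ℝ,
      (∀ x ∈ (Kerr.exterior M a : Set E4), ContDiffAt ℝ 2 Φ x) →
      (∀ x ∈ (Kerr.exterior M a : Set E4), Kerr.radius a x ≤ Kerr.rPlus M a + η →
        F (E4.spatial x) ≤ x 0 →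
        KerrSchild.waveOperator
          (KerrSchild.inverseMetric (fun y ↦ 2 * Kerr.scalarH M a y) (Kerr.nullVector a)) Φ x = 0) →
      ∀ s : ℝ, 0 ≤ s →
        (∫⁻ y, {y : E3 | Kerr.rPlus M a < Kerr.radius a (E4.ofTimeSpace (s + F y) y) ∧
              Kerr.radius a (E4.ofTimeSpace (s + F y) y) ≤ Kerr.rPlus M a + η / 2}.indicator
            (fun y ↦ ENNReal.ofReal
              (∑ μ, fderiv ℝ Φ (E4.ofTimeSpace (s + F y) y) (E4.basisVector μ) ^ 2)) y) +
          ∫⁻ u in Set.Ioc 0 s, ∫⁻ y,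
            {y : E3 | Kerr.rPlus M a < Kerr.radius a (E4.ofTimeSpace (u + F y) y) ∧
              Kerr.radius a (E4.ofTimeSpace (u + F y) y) ≤ Kerr.rPlus M a + η / 2}.indicator
            (fun y ↦ ENNReal.ofReal
              (∑ μ, fderiv ℝ Φ (E4.ofTimeSpace (u + F y) y) (E4.basisVector μ) ^ 2)) y ≤
        ENNReal.ofReal (C / c) *
          ((∫⁻ y, {y : E3 | Kerr.rPlus M a < Kerr.radius a (E4.ofTimeSpace (0 + F y) y) ∧
                Kerr.radius a (E4.ofTimeSpace (0 + F y) y) ≤ Kerr.rPlus M a + η}.indicator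
              (fun y ↦ ENNReal.ofReal
                (∑ μ, fderiv ℝ Φ (E4.ofTimeSpace (0 + F y) y) (E4.basisVector μ) ^ 2)) y) +
            ∫⁻ u in Set.Ioc 0 s, ∫⁻ y,
              {y : E3 | Kerr.rPlus M a + η / 2 ≤ Kerr.radius a (E4.ofTimeSpace (u + F y) y) ∧
                Kerr.radius a (E4.ofTimeSpace (u + F y) y) ≤ Kerr.rPlus M a + η}.indicator
              (fun y ↦ ENNReal.ofReal
                (∑ μ, fderiv ℝ Φ (E4.ofTimeSpace (u + F y) y) (E4.basisVector μ) ^ 2)) y) := by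
  intro M a hMa
  obtain ⟨η₀, hη₀, hest₀⟩ := redShift_weighted_estimate_local M a hMa
  refine ⟨η₀, hη₀, fun η hη hηle ↦ ?_⟩
  obtain ⟨A, C, hA, hC0, hest⟩ := hest₀ η hη hηle
  have hrp : 0 < rPlus M a := hMa.rPlus_pos
  set R₁ : ℝ := rPlus M a + η / 2 with hR₁
  set R₂ : ℝ := rPlus M a + η with hR₂
  have hR₁pos : 0 < R₁ := by positivity
  have hR12 : R₁ < R₂ := by rw [hR₁, hR₂]; linarith
  have hrR₁ : rPlus M a < R₁ := by rw [hR₁]; linarith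
  obtain ⟨L, hL0, hL⟩ := exists_abs_fderiv_collarCutoff_le (a := a) hR₁pos hR12
  have hC1 : 0 < C + 1 := by linarith
  set C₆ : ℝ := (C + 1) / A * (1 + 4 * L) with hC₆
  have hC₆pos : 0 < C₆ := mul_pos (div_pos hC1 hA) (by linarith)
  refine ⟨C₆, hC₆pos, fun F c hF hc hc1 hslope Φ hΦ hsol s hs ↦ ?_⟩
  -- ### the equation on the surgered background; the slope of `F`
  set B := surgeryBackground M a (rPlus M a) hMa.pos.le hMa.rPlus_pos with hB
  have hsolB : ∀ x ∈ (exterior M a : Set E4), radius a x ≤ rPlus M a + η →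
      F (E4.spatial x) ≤ x 0 → KerrSchild.waveOperator B.inverseMetric Φ x = 0 := by
    intro x hx hxη hxF
    rw [← KerrSchild.waveOperator_congr_of_eventuallyEq
      (surgeryBackground_inverseMetric_eventuallyEq M a hMa.pos.le hMa.rPlus_pos ⟨x, hx⟩) Φ]
    exact hsol x hx hxη hxF
  have hFc : ∀ y, ∑ i, partialE3 F y i ^ 2 ≤ (1 - c) ^ 2 := fun y ↦
    (sum_sq_partialE3_le F y).trans (pow_le_pow_left₀ (norm_nonneg _) (hslope y) 2)
  -- ### notation
  set ρ : ℝ := √(R₂ ^ 2 + a ^ 2) with hρ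
  set χ : E4 → ℝ := collarCutoff a R₁ R₂ with hχ
  set V : E4 → ℝ := fun x ↦ ∑ μ, |fderiv ℝ χ x (E4.basisVector μ)| with hV
  set p2 : E4 → ℝ := fun x ↦ ∑ μ, fderiv ℝ Φ x (E4.basisVector μ) ^ 2 with hp2
  set fd : ℝ → E3 → ℝ≥0∞ := fun t y ↦
    ENNReal.ofReal (∑ μ, fderiv ℝ Φ (E4.ofTimeSpace (t + F y) y) (E4.basisVector μ) ^ 2) with hfd
  set T : ℝ → ℝ → Set E3 := fun R t ↦ {y | rPlus M a < radius a (E4.ofTimeSpace (t + F y) y) ∧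
    radius a (E4.ofTimeSpace (t + F y) y) ≤ R} with hT
  set Sh : ℝ → Set E3 := fun t ↦ {y | R₁ ≤ radius a (E4.ofTimeSpace (t + F y) y) ∧
    radius a (E4.ofTimeSpace (t + F y) y) ≤ R₂} with hSh
  set S : ℕ → ℝ → Set E3 := fun n t ↦
    {y | 2 * (1 / ((n : ℝ) + 1)) ≤ horizonFn M a (E4.ofTimeSpace (t + F y) y) ∧
      radius a (E4.ofTimeSpace (t + F y) y) ≤ R₁} with hS
  set E0 : ℝ≥0∞ := ∫⁻ y, (T R₂ 0).indicator (fd 0) y with hE0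
  set ShI : ℝ≥0∞ := ∫⁻ u in Set.Ioc 0 s, ∫⁻ y, (Sh u).indicator (fd u) y with hShI
  show (∫⁻ y, (T R₁ s).indicator (fd s) y) + ∫⁻ u in Set.Ioc 0 s, ∫⁻ y, (T R₁ u).indicator (fd u) y
    ≤ ENNReal.ofReal (C₆ / c) * (E0 + ShI)
  have hmemS : ∀ n t y, y ∈ S n t ↔
      2 * (1 / ((n : ℝ) + 1)) ≤ horizonFn M a (E4.ofTimeSpace (t + F y) y) ∧
        radius a (E4.ofTimeSpace (t + F y) y) ≤ R₁ := fun _ _ _ ↦ Iff.rfl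
  have hmemT : ∀ R t y, y ∈ T R t ↔ rPlus M a < radius a (E4.ofTimeSpace (t + F y) y) ∧
      radius a (E4.ofTimeSpace (t + F y) y) ≤ R := fun _ _ _ ↦ Iff.rfl
  -- ### continuity and measurability
  have hp2nn : ∀ x, 0 ≤ p2 x := fun x ↦ Finset.sum_nonneg fun μ _ ↦ sq_nonneg _
  have hV0 : ∀ x, 0 ≤ V x := fun x ↦ Finset.sum_nonneg fun μ _ ↦ abs_nonneg _
  have hVle : ∀ x, V x ≤ 4 * L := fun x ↦ by
    calc V x = ∑ μ, |fderiv ℝ χ x (E4.basisVector μ)| := rfl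
      _ ≤ ∑ _μ : Fin 4, L := Finset.sum_le_sum fun μ _ ↦ (hL x μ).1
      _ = 4 * L := by
          simp only [Finset.sum_const, Finset.card_univ, Fintype.card_fin, nsmul_eq_mul,
            Nat.cast_ofNat]
  have hgraph : ∀ t : ℝ, Continuous fun y : E3 ↦ E4.ofTimeSpace (t + F y) y := fun t ↦
    E4.continuous_ofTimeSpace' (continuous_const.add hF.continuous) continuous_id
  have hgraph2 : Continuous fun p : ℝ × E3 ↦ E4.ofTimeSpace (p.1 + F p.2) p.2 :=
    E4.continuous_ofTimeSpace' (continuous_fst.add (hF.continuous.comp continuous_snd))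
      continuous_snd
  have hf2m : Measurable fun p : ℝ × E3 ↦
      ENNReal.ofReal (∑ μ, fderiv ℝ Φ (E4.ofTimeSpace (p.1 + F p.2) p.2) (E4.basisVector μ) ^ 2) := by
    refine ENNReal.measurable_ofReal.comp (Finset.measurable_sum _ fun μ _ ↦ ?_)
    exact ((measurable_fderiv_apply_const ℝ Φ (E4.basisVector μ)).comp hgraph2.measurable).pow_const 2
  have hhc : Continuous (horizonFn M a) := continuous_horizonFn M a
  -- continuity of the densities on `ℝ⁴`
  have hp2c : ∀ x ∈ (exterior M a : Set E4), ContinuousAt p2 x := by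
    intro x hx
    have h2 : ContDiffAt ℝ ((1 : ℕ∞) + 1 : ℕ∞) Φ x := by exact_mod_cast hΦ x hx
    exact tendsto_finsetSum _ fun ν _ ↦
      (((h2.fderiv_right (m := 1) le_rfl).clm_apply contDiffAt_const).continuousAt).pow 2
  have hχ1 : ContDiff ℝ 1 χ := contDiff_collarCutoff hR₁pos hR12
  set Ksh : Set E4 := {x | R₁ ≤ radius a x ∧ radius a x ≤ R₂} with hKsh
  have hKshc : IsClosed Ksh := by
    rw [hKsh, Set.setOf_and]
    exact (isClosed_le continuous_const (continuous_radius a)).inter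
      (isClosed_le (continuous_radius a) continuous_const)
  have hKshU : Ksh ⊆ (exterior M a : Set E4) := fun x hx ↦
    mem_exterior.2 (max_lt (hrR₁.trans_le hx.1) (hrp.trans (hrR₁.trans_le hx.1)))
  have hVc : Continuous V :=
    continuous_finsetSum _ fun μ _ ↦
      ((hχ1.continuous_fderiv one_ne_zero).clm_apply continuous_const).abs
  have hVz : ∀ x, x ∉ Ksh → V x = 0 := by
    intro x hx
    refine Finset.sum_eq_zero fun μ _ ↦ ?_
    by_contra hne
    exact hx ((hL x μ).2 (fun h0 ↦ hne (by rw [h0, abs_zero])))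
  have hVp2c : Continuous fun x ↦ V x * p2 x :=
    continuous_iff_continuousAt.mpr fun x ↦ continuousAt_weight_mul hKshc hKshU hVc hVz hp2c x
  set Zt : ℝ → ℝ := fun t ↦ ∫ y in closedBall (0 : E3) ρ,
    V (E4.ofTimeSpace (t + F y) y) * p2 (E4.ofTimeSpace (t + F y) y) with hZt
  have hZc : Continuous Zt :=
    continuous_parametric_integral_of_continuous
      (f := fun (t : ℝ) (y : E3) ↦ V (E4.ofTimeSpace (t + F y) y) * p2 (E4.ofTimeSpace (t + F y) y))
      (hVp2c.comp hgraph2) (isCompact_closedBall _ _)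
  have hZnn : ∀ t, 0 ≤ Zt t := fun t ↦
    setIntegral_nonneg measurableSet_closedBall fun y _ ↦ mul_nonneg (hV0 _) (hp2nn _)
  have hZi : ∀ t, IntegrableOn
      (fun y : E3 ↦ V (E4.ofTimeSpace (t + F y) y) * p2 (E4.ofTimeSpace (t + F y) y))
      (closedBall (0 : E3) ρ) := fun t ↦
    (hVp2c.comp (hgraph t)).continuousOn.integrableOn_compact (isCompact_closedBall _ _)
  set Z : ℝ := ∫ u in Set.Ioc 0 s, Zt u with hZ
  have hZnn' : 0 ≤ Z := setIntegral_nonneg measurableSet_Ioc fun u _ ↦ hZnn u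
  -- the error term: `Z ≤ 4L · ShI`
  have herr : ENNReal.ofReal Z ≤ ENNReal.ofReal (4 * L) * ShI := by
    have h1 : ∀ u, ENNReal.ofReal (Zt u) ≤
        ENNReal.ofReal (4 * L) * ∫⁻ y, (Sh u).indicator (fd u) y := by
      intro u
      rw [show Zt u = ∫ y in closedBall (0 : E3) ρ,
          V (E4.ofTimeSpace (u + F y) y) * p2 (E4.ofTimeSpace (u + F y) y) from rfl,
        ofReal_integral_eq_lintegral_ofReal (hZi u)
          (ae_of_all _ fun y ↦ mul_nonneg (hV0 _) (hp2nn _)),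
        ← lintegral_const_mul' _ _ ENNReal.ofReal_ne_top]
      calc ∫⁻ y in closedBall (0 : E3) ρ,
            ENNReal.ofReal (V (E4.ofTimeSpace (u + F y) y) * p2 (E4.ofTimeSpace (u + F y) y))
          ≤ ∫⁻ y in closedBall (0 : E3) ρ, ENNReal.ofReal (4 * L) * (Sh u).indicator (fd u) y := by
            refine lintegral_mono fun y ↦ ?_
            by_cases hy : E4.ofTimeSpace (u + F y) y ∈ Ksh
            · have hyS : y ∈ Sh u := hy
              rw [Set.indicator_of_mem hyS, ← ENNReal.ofReal_mul (by positivity)]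
              exact ENNReal.ofReal_le_ofReal (mul_le_mul_of_nonneg_right (hVle _) (hp2nn _))
            · rw [hVz _ hy, zero_mul, ENNReal.ofReal_zero]
              exact zero_le
        _ ≤ ∫⁻ y, ENNReal.ofReal (4 * L) * (Sh u).indicator (fd u) y :=
            setLIntegral_le_lintegral _ _
    calc ENNReal.ofReal Z = ∫⁻ u in Set.Ioc 0 s, ENNReal.ofReal (Zt u) :=
          ofReal_integral_eq_lintegral_ofReal
            (hZc.integrableOn_Icc.mono_set Set.Ioc_subset_Icc_self) (ae_of_all _ fun u ↦ hZnn u)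
      _ ≤ ∫⁻ u in Set.Ioc 0 s, ENNReal.ofReal (4 * L) * ∫⁻ y, (Sh u).indicator (fd u) y :=
          lintegral_mono fun u ↦ h1 u
      _ = ENNReal.ofReal (4 * L) * ShI := by
          rw [hShI, lintegral_const_mul' _ _ ENNReal.ofReal_ne_top]
  -- ### Step 1: the estimate at receding parameter `ε = 1/(n+1)`
  have hstep : ∀ n : ℕ, (∫⁻ y, (S n s).indicator (fd s) y) +
      ∫⁻ u in Set.Ioc 0 s, ∫⁻ y, (S n u).indicator (fd u) y ≤
        ENNReal.ofReal (C₆ / c) * (E0 + ShI) := by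
    intro n
    set ε : ℝ := 1 / ((n : ℝ) + 1) with hεdef
    have hε : 0 < ε := by positivity
    set W : E4 → ℝ := redShiftWeight M a R₁ R₂ ε with hW
    set K : Set E4 := redShiftWeightSet M a R₂ ε with hK
    have hKc : IsClosed K := isClosed_redShiftWeightSet M a R₂ ε
    have hKU : K ⊆ (exterior M a : Set E4) := redShiftWeightSet_subset_exterior hrp hε
    have hWK : ∀ x, W x ≠ 0 → x ∈ K := fun x hx ↦ mem_redShiftWeightSet_of_ne_zero hR12 hε hx
    have hWz : ∀ x, x ∉ K → W x = 0 := fun x hx ↦ by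
      by_contra h
      exact hx (hWK x h)
    have hW1 : ContDiff ℝ 1 W := contDiff_redShiftWeight hR₁pos hR12 hrp hε
    have hW0 : ∀ x, 0 ≤ W x := redShiftWeight_nonneg M a R₁ R₂ ε
    have hWle : ∀ x, W x ≤ 1 := redShiftWeight_le_one M a R₁ R₂ ε
    have hWp2c : Continuous fun x ↦ W x * p2 x :=
      continuous_iff_continuousAt.mpr fun x ↦
        continuousAt_weight_mul hKc hKU hW1.continuous hWz hp2c x
    -- the real slice integrals of the weighted density
    set Xt : ℝ → ℝ := fun t ↦ ∫ y in closedBall (0 : E3) ρ,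
      W (E4.ofTimeSpace (t + F y) y) * p2 (E4.ofTimeSpace (t + F y) y) with hXt
    have hXc : Continuous Xt :=
      continuous_parametric_integral_of_continuous
        (f := fun (t : ℝ) (y : E3) ↦ W (E4.ofTimeSpace (t + F y) y) * p2 (E4.ofTimeSpace (t + F y) y))
        (hWp2c.comp hgraph2) (isCompact_closedBall _ _)
    have hXnn : ∀ t, 0 ≤ Xt t := fun t ↦
      setIntegral_nonneg measurableSet_closedBall fun y _ ↦ mul_nonneg (hW0 _) (hp2nn _)
    have hXi : ∀ t, IntegrableOn
        (fun y : E3 ↦ W (E4.ofTimeSpace (t + F y) y) * p2 (E4.ofTimeSpace (t + F y) y))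
        (closedBall (0 : E3) ρ) := fun t ↦
      (hWp2c.comp (hgraph t)).continuousOn.integrableOn_compact (isCompact_closedBall _ _)
    set Y : ℝ := ∫ u in Set.Ioc 0 s, Xt u with hY
    have hYnn : 0 ≤ Y := setIntegral_nonneg measurableSet_Ioc fun u _ ↦ hXnn u
    -- the weighted estimate of Part 5
    have hw : A * c * Xt s + A * Y ≤ C * Xt 0 + C * Z := by
      have h := hest F c hF hc hc1 hFc Φ hΦ hsolB ε hε s hs
      simpa only [hXt, hY, hZ, hZt, hW, hV, hp2, hχ] using h
    -- the real inequality `Xt s + Y ≤ (C + 1)/(A c) · (Xt 0 + Z)`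
    have hkey : Xt s + Y ≤ (C + 1) / (A * c) * (Xt 0 + Z) := by
      have hX0 := hXnn 0
      have hXs := hXnn s
      have h1 : A * c * Y ≤ A * Y := by
        have : A * c ≤ A := by nlinarith only [hA, hc1]
        exact mul_le_mul_of_nonneg_right this hYnn
      have h2 : C * Xt 0 + C * Z ≤ (C + 1) * (Xt 0 + Z) := by nlinarith only [hX0, hZnn']
      rw [div_mul_eq_mul_div, le_div_iff₀ (mul_pos hA hc)]
      nlinarith only [h1, h2, hw]
    -- (a) the leaf integrals from below: `W = 1` on `S n t ⊆ {‖y‖ ≤ ρ}`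
    have hSK : ∀ t y, y ∈ S n t → E4.ofTimeSpace (t + F y) y ∈ K := fun t y hy ↦ by
      rw [hmemS] at hy
      refine ⟨?_, hy.2.trans hR12.le⟩
      show ε ≤ horizonFn M a (E4.ofTimeSpace (t + F y) y)
      rw [hεdef]
      linarith [hy.1, hε.le]
    have hSball : ∀ t, S n t ⊆ closedBall (0 : E3) ρ := fun t y hy ↦ by
      rw [mem_closedBall, dist_zero_right]
      have h := spatialNorm_le_of_mem_redShiftWeightSet hrp hε (hSK t y hy)
      rwa [E4.spatialNorm_ofTimeSpace] at h
    have hW1S : ∀ t y, y ∈ S n t → W (E4.ofTimeSpace (t + F y) y) = 1 := fun t y hy ↦ by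
      rw [hmemS] at hy
      refine redShiftWeight_eq_one hR12 hε ?_ hy.2
      rw [hεdef]
      exact hy.1
    have hleaf : ∀ t, ∫⁻ y, (S n t).indicator (fd t) y ≤ ENNReal.ofReal (Xt t) := by
      intro t
      calc ∫⁻ y, (S n t).indicator (fd t) y
          ≤ ∫⁻ y, (closedBall (0 : E3) ρ).indicator (fun y ↦ ENNReal.ofReal
              (W (E4.ofTimeSpace (t + F y) y) * p2 (E4.ofTimeSpace (t + F y) y))) y := by
            refine lintegral_mono fun y ↦ ?_
            by_cases hy : y ∈ S n t
            · rw [Set.indicator_of_mem hy, Set.indicator_of_mem (hSball t hy), hW1S t y hy, one_mul]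
            · rw [Set.indicator_of_notMem hy]
              exact zero_le
        _ = ENNReal.ofReal (Xt t) := by
            rw [lintegral_indicator measurableSet_closedBall]
            exact (ofReal_integral_eq_lintegral_ofReal (hXi t)
              (ae_of_all _ fun y ↦ mul_nonneg (hW0 _) (hp2nn _))).symm
    -- (b) the bulk from below
    have hbulk : ∫⁻ u in Set.Ioc 0 s, ∫⁻ y, (S n u).indicator (fd u) y ≤ ENNReal.ofReal Y := by
      calc ∫⁻ u in Set.Ioc 0 s, ∫⁻ y, (S n u).indicator (fd u) y
          ≤ ∫⁻ u in Set.Ioc 0 s, ENNReal.ofReal (Xt u) := lintegral_mono fun u ↦ hleaf u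
        _ = ENNReal.ofReal Y :=
            (ofReal_integral_eq_lintegral_ofReal
              (hXc.integrableOn_Icc.mono_set Set.Ioc_subset_Icc_self)
              (ae_of_all _ fun u ↦ hXnn u)).symm
    -- (c) the initial leaf integral from above: `W ≤ 1_{r₊ < r ≤ R₂}`
    have hinit : ENNReal.ofReal (Xt 0) ≤ E0 := by
      rw [show Xt 0 = ∫ y in closedBall (0 : E3) ρ,
          W (E4.ofTimeSpace (0 + F y) y) * p2 (E4.ofTimeSpace (0 + F y) y) from rfl,
        ofReal_integral_eq_lintegral_ofReal (hXi 0)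
          (ae_of_all _ fun y ↦ mul_nonneg (hW0 _) (hp2nn _))]
      calc ∫⁻ y in closedBall (0 : E3) ρ,
            ENNReal.ofReal (W (E4.ofTimeSpace (0 + F y) y) * p2 (E4.ofTimeSpace (0 + F y) y))
          ≤ ∫⁻ y in closedBall (0 : E3) ρ, (T R₂ 0).indicator (fd 0) y := by
            refine lintegral_mono fun y ↦ ?_
            by_cases hWy : W (E4.ofTimeSpace (0 + F y) y) = 0
            · rw [hWy, zero_mul, ENNReal.ofReal_zero]
              exact zero_le
            · have hmem : E4.ofTimeSpace (0 + F y) y ∈ K := hWK _ hWy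
              have hyT : y ∈ T R₂ 0 :=
                (hmemT R₂ 0 y).2 ⟨rPlus_lt_radius_of_mem_redShiftWeightSet hε hmem, hmem.2⟩
              rw [Set.indicator_of_mem hyT]
              refine ENNReal.ofReal_le_ofReal ?_
              calc W (E4.ofTimeSpace (0 + F y) y) * p2 (E4.ofTimeSpace (0 + F y) y)
                  ≤ 1 * p2 (E4.ofTimeSpace (0 + F y) y) :=
                    mul_le_mul_of_nonneg_right (hWle _) (hp2nn _)
                _ = p2 (E4.ofTimeSpace (0 + F y) y) := one_mul _
        _ ≤ E0 := setLIntegral_le_lintegral _ _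
    -- (d) assemble in `[0, ∞]`
    have hq0 : 0 < (C + 1) / (A * c) := div_pos hC1 (mul_pos hA hc)
    have hqC₆ : (C + 1) / (A * c) * (1 + 4 * L) = C₆ / c := by
      rw [hC₆]
      field_simp
    have hq4 : 0 ≤ (C + 1) / (A * c) * (4 * L) := mul_nonneg hq0.le (by positivity)
    have hqexp : (C + 1) / (A * c) * (1 + 4 * L) =
        (C + 1) / (A * c) + (C + 1) / (A * c) * (4 * L) := by ring
    have hr1 : (C + 1) / (A * c) ≤ C₆ / c := by
      rw [← hqC₆, hqexp]
      linarith only [hq4]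
    have hr2 : (C + 1) / (A * c) * (4 * L) ≤ C₆ / c := by
      rw [← hqC₆, hqexp]
      linarith only [hq0]
    calc (∫⁻ y, (S n s).indicator (fd s) y) + ∫⁻ u in Set.Ioc 0 s, ∫⁻ y, (S n u).indicator (fd u) y
        ≤ ENNReal.ofReal (Xt s) + ENNReal.ofReal Y := add_le_add (hleaf s) hbulk
      _ = ENNReal.ofReal (Xt s + Y) := (ENNReal.ofReal_add (hXnn s) hYnn).symm
      _ ≤ ENNReal.ofReal ((C + 1) / (A * c) * (Xt 0 + Z)) := ENNReal.ofReal_le_ofReal hkey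
      _ = ENNReal.ofReal ((C + 1) / (A * c)) * (ENNReal.ofReal (Xt 0) + ENNReal.ofReal Z) := by
          rw [ENNReal.ofReal_mul hq0.le, ENNReal.ofReal_add (hXnn 0) hZnn']
      _ ≤ ENNReal.ofReal ((C + 1) / (A * c)) * (E0 + ENNReal.ofReal (4 * L) * ShI) := by
          gcongr
      _ = ENNReal.ofReal ((C + 1) / (A * c)) * E0 +
            ENNReal.ofReal ((C + 1) / (A * c) * (4 * L)) * ShI := by
          rw [mul_add, ENNReal.ofReal_mul hq0.le, mul_assoc]
      _ ≤ ENNReal.ofReal (C₆ / c) * E0 + ENNReal.ofReal (C₆ / c) * ShI := by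
          gcongr
      _ = ENNReal.ofReal (C₆ / c) * (E0 + ShI) := (mul_add _ _ _).symm
  -- ### Step 2: exhaustion `n → ∞`
  exact redShift_lintegral_exhaustion
    (h := fun t y ↦ horizonFn M a (E4.ofTimeSpace (t + F y) y))
    (r := fun t y ↦ radius a (E4.ofTimeSpace (t + F y) y))
    (q := fun t y ↦ rPlus M a < radius a (E4.ofTimeSpace (t + F y) y)) (f := fd)
    (hhc.comp hgraph2) ((continuous_radius a).comp hgraph2)
    (fun t y ↦ ⟨fun hlt ↦ mul_pos (sub_pos.mpr hlt) (Real.exp_pos _),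
      rPlus_lt_radius_of_horizonFn_pos⟩) hf2m R₁ s hstep

end Summit.FinalStateConjecture.FinalStateConjecture.Cruxes.AdiabaticMultiKerrILED.Sketch
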